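import Summits.Ventures.LatticeQCDFlow.Exactness.ReversibleVariationalCeilingPositive
import Summits.Ventures.LatticeQCDFlow.Exactness.ReversiblePositive
import HarnessLib

/-!
# The variational ceiling TERMWISE: a positive sampler with `(∫ g v w)² ≤ B·𝓔(v)` has `C_g(N) ≤ B/(N+1)` at every lag — algebraic decorrelation from the cap alone

HONEST FRAMING: exact (Metropolis-corrected) sampling algorithms for lattice gauge theory;
figures of merit are autocorrelation/cost numbers at stated couplings and volumes; no
continuum-physics claim.  (SCALAR calibration rung S0-A: not a gauge result.)

Venture `LatticeQCDFlow` (cell pub-lqcd), topic `Exactness`; FANOUT row 2 (`s0-phi4`).  NEW WORK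
of the cell over `Exactness/ReversibleVariationalCeilingPositive.lean` (every partial Green–Kubo sum
`Σ_{k<N} C_g(k) ≤ B`) and `Exactness/ReversiblePositive.lean` (a positive sampler has NONINCREASING
nonnegative autocovariances).  Elementary; nothing is cited as a fact.

## Why this file

The geometric decay `ρ_g(k) ≤ (1 − Z/C)ᵏ` of the flow arm (`FlowSamplerSquareIntegrableDecay`, GEN-20)
needs the sup-norm weight bound `e^{−S} ≤ C q̃`.  The acceptance-weighted cap `B_g = G₂ Z/P_ρ` of
GEN-21 (`FlowSamplerSquareIntegrableAcceptanceCeiling`) needs only the equilibrium column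
`G₂ = ∫ g² e^{−S}/ρ < ∞`.  Here: the cap alone — for ANY positive sampler in the `RevOp` format —
already forces ALGEBRAIC decorrelation lag by lag, `C_g(N) ≤ B/(N+1)`, because the autocovariances
are nonincreasing and their partial sums are capped (`(N+1)·C_g(N) ≤ Σ_{k≤N} C_g(k) ≤ B`).

## What is proved (namespace `RevOp`; (int), (comb), (stab), (lin), (symm), (contr), (pos);
`g ∈ A`, `C(k) = ∫ g (Kᵏ g) w`, `P = C(0)`; `0 ≤ B` with `(∫ g v w)² ≤ B·𝓔(v)` for all `v ∈ A`)

* `sum_range_succ_ge_of_antitone` — `(N+1)·C(N) ≤ Σ_{k<N+1} C(k)` for a nonincreasing `C` (real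
  sequences; arithmetic);
* **`autocov_le_div_of_forall_sq_inner_le_dirichlet_of_pos`** — `C_g(N) ≤ B/(N+1)` for every `N`;
* **`autocorr_le_div_of_forall_sq_inner_le_dirichlet_of_pos`** — `P > 0 ⇒ ρ_g(N) ≤ (B/P)/(N+1)`:
  the lag-`N` autocorrelation is at most `(τ-ceiling + ½)/(N+1)`.

The flow-arm instances (`ρ_g(N) ≤ (E_{g²}[1/ρ]/ā)/(N+1) = ((1 + S_g)/ā)/(N+1)` for every
square-integrable `g`, the magnetisation of lattice φ⁴ included) are `Phi4FlowSquareIntegrableBracket`.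
NOT CLAIMED: positivity or a variational cap for the HMC / local arms; any number for any run.
-/

namespace Summit.Ventures.LatticeQCDFlow.Exactness

open Real MeasureTheory Filter Finset
open Summit.Ventures.LatticeQCDFlow.Scoring

namespace RevOp

variable {X : Type*} [MeasurableSpace X] {μ : Measure X} {w : X → ℝ} {A : (X → ℝ) → Prop}
  {K : (X → ℝ) → (X → ℝ)}

omit [MeasurableSpace X] in
/-- **`(N+1)·C(N) ≤ Σ_{k<N+1} C(k)`** for a sequence with `C(k+1) ≤ C(k)` (each of the `N+1` summands
is at least the last one). -/
theorem sum_range_succ_ge_of_antitone {C : ℕ → ℝ} (hC : ∀ k, C (k + 1) ≤ C k) (N : ℕ) :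
    ((N : ℝ) + 1) * C N ≤ ∑ k ∈ Finset.range (N + 1), C k := by
  have hmono : ∀ k N, k ≤ N → C N ≤ C k := by
    intro k N hkN
    induction N, hkN using Nat.le_induction with
    | base => exact le_rfl
    | succ m _ ih => exact (hC m).trans ih
  calc ((N : ℝ) + 1) * C N = ∑ _k ∈ Finset.range (N + 1), C N := by
        rw [Finset.sum_const, Finset.card_range, nsmul_eq_mul]; push_cast; ring
    _ ≤ ∑ k ∈ Finset.range (N + 1), C k :=
        Finset.sum_le_sum fun k hk => hmono k N (Nat.lt_succ_iff.1 (Finset.mem_range.1 hk))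

/-- **ALGEBRAIC DECORRELATION FROM THE VARIATIONAL CAP.**  `RevOp` format with (pos); `g ∈ A`;
`0 ≤ B` with `(∫ g v w)² ≤ B·𝓔(v)` for every `v ∈ A`.  Then for every lag `N`:
**`C_g(N) ≤ B/(N+1)`** (nonincreasing autocovariances + capped partial sums). -/
theorem autocov_le_div_of_forall_sq_inner_le_dirichlet_of_pos (hw0 : ∀ x, 0 ≤ w x)
    (hAi : ∀ ⦃f h : X → ℝ⦄, A f → A h → Integrable (fun x => f x * h x * w x) μ)
    (hAc : ∀ ⦃f h : X → ℝ⦄ (c : ℝ), A f → A h → A (fun x => f x + c * h x))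
    (hAK : ∀ ⦃f : X → ℝ⦄, A f → A (K f))
    (hlin : ∀ ⦃f h : X → ℝ⦄ (c : ℝ), A f → A h →
      ∀ x, K (fun s => f s + c * h s) x = K f x + c * K h x)
    (hsymm : ∀ ⦃f h : X → ℝ⦄, A f → A h →
      ∫ x, K f x * h x * w x ∂μ = ∫ x, f x * K h x * w x ∂μ)
    (hcontr : ∀ ⦃f : X → ℝ⦄, A f → ∫ x, K f x ^ 2 * w x ∂μ ≤ ∫ x, f x ^ 2 * w x ∂μ)
    (hpos : ∀ ⦃f : X → ℝ⦄, A f → 0 ≤ ∫ x, f x * K f x * w x ∂μ)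
    {g : X → ℝ} (hg : A g) {B : ℝ} (hB : 0 ≤ B)
    (h : ∀ ⦃v : X → ℝ⦄, A v → (∫ x, g x * v x * w x ∂μ) ^ 2
        ≤ B * ((∫ x, v x ^ 2 * w x ∂μ) - ∫ x, v x * K v x * w x ∂μ)) (N : ℕ) :
    ∫ x, g x * (K^[N] g) x * w x ∂μ ≤ B / ((N : ℝ) + 1) := by
  set C : ℕ → ℝ := fun k => ∫ x, g x * (K^[k] g) x * w x ∂μ with hC
  have hanti : ∀ k, C (k + 1) ≤ C k := fun k =>
    autocov_succ_le_of_pos hw0 hAi hAc hAK hlin hsymm hcontr hpos hg k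
  have hnn : ∀ k, 0 ≤ C k := fun k => autocov_nonneg_of_pos hw0 hAK hsymm hpos hg k
  have hcap : ∑ k ∈ Finset.range (N + 1), C k ≤ B :=
    sum_range_autocov_le_of_forall_sq_inner_le_dirichlet hAi hAc hAK hlin hsymm hg hnn hB h (N + 1)
  have hlow := sum_range_succ_ge_of_antitone hanti N
  have hN : 0 < (N : ℝ) + 1 := by positivity
  rw [le_div_iff₀ hN]
  show C N * ((N : ℝ) + 1) ≤ B
  linarith

/-- **Normalised form**: with `P = C_g(0) > 0`, **`ρ_g(N) ≤ (B/P)/(N+1)`** — the lag-`N`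
autocorrelation of a positive sampler is at most its variational `τ`-ceiling-plus-one-half divided by
`N+1`. -/
theorem autocorr_le_div_of_forall_sq_inner_le_dirichlet_of_pos (hw0 : ∀ x, 0 ≤ w x)
    (hAi : ∀ ⦃f h : X → ℝ⦄, A f → A h → Integrable (fun x => f x * h x * w x) μ)
    (hAc : ∀ ⦃f h : X → ℝ⦄ (c : ℝ), A f → A h → A (fun x => f x + c * h x))
    (hAK : ∀ ⦃f : X → ℝ⦄, A f → A (K f))
    (hlin : ∀ ⦃f h : X → ℝ⦄ (c : ℝ), A f → A h →
      ∀ x, K (fun s => f s + c * h s) x = K f x + c * K h x)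
    (hsymm : ∀ ⦃f h : X → ℝ⦄, A f → A h →
      ∫ x, K f x * h x * w x ∂μ = ∫ x, f x * K h x * w x ∂μ)
    (hcontr : ∀ ⦃f : X → ℝ⦄, A f → ∫ x, K f x ^ 2 * w x ∂μ ≤ ∫ x, f x ^ 2 * w x ∂μ)
    (hpos : ∀ ⦃f : X → ℝ⦄, A f → 0 ≤ ∫ x, f x * K f x * w x ∂μ)
    {g : X → ℝ} (hg : A g) (hP : 0 < ∫ x, g x ^ 2 * w x ∂μ) {B : ℝ} (hB : 0 ≤ B)
    (h : ∀ ⦃v : X → ℝ⦄, A v → (∫ x, g x * v x * w x ∂μ) ^ 2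
        ≤ B * ((∫ x, v x ^ 2 * w x ∂μ) - ∫ x, v x * K v x * w x ∂μ)) (N : ℕ) :
    (∫ x, g x * (K^[N] g) x * w x ∂μ) / (∫ x, g x ^ 2 * w x ∂μ)
      ≤ B / (∫ x, g x ^ 2 * w x ∂μ) / ((N : ℝ) + 1) := by
  have hle := autocov_le_div_of_forall_sq_inner_le_dirichlet_of_pos hw0 hAi hAc hAK hlin hsymm hcontr
    hpos hg hB h N
  rw [div_div, mul_comm, ← div_div]
  exact div_le_div_of_nonneg_right hle hP.le

end RevOp

end Summit.Ventures.LatticeQCDFlow.Exactness
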